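import Mathlib
import Literature.NumberTheory.Irrationality.Zudilin2003.CatalanRecursion
import HarnessLib

/-!
# Krattenthaler–Rivoal 2008: the binomial form of Zudilin's Catalan coefficient `u_n` and `2^{4n} u_n ∈ ℤ` (PROVED)

Topic `Literature/NumberTheory/Irrationality/KrattenthalerRivoal2008`. FORMALISATION (theorems, no named facts) of
C. Krattenthaler, T. Rivoal, *On a linear form for Catalan's constant*, South East Asian J. Math. Math. Sci. **6**:2
(2008) 3–15 = arXiv:0810.1927 [KrattenthalerRivoal2008Catalan], Sect. 3: **Lemma 3** ("For all non-negative integers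
`n`, we have `a_n = −4 Σ_{j=0}^{n} binom(n,j) binom(n−½,j) binom(n+j−½,j)`", a formula "already given in [RivoAG]" =
T. Rivoal, *Nombres d'Euler, approximants de Padé et constante de Catalan*, Ramanujan J. 11 (2006) 199–214) and
**Theorem 1** ("For all positive integers `n`, the number `2^{4n} a_n` is an integer"), read on the page
[corpus: paper:arxiv-0810.1927, Sect. 2–3]. Here `a_n = −4u_n` for Zudilin's solution `u_n` of the Apéry-like
recursion for Catalan's constant (`Zudilin2003.u`: arXiv:math/0201024 (2)–(4); the source's `G_n = a_nG − b_n` is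
`−4(u_nG − v_n)`, the bridge recorded with the cell's named fact `Zudilin2003.krTheorems`). HONEST FRAMING (cell
pub-zeta5): systematic search; no irrationality claim unless certified — Catalan's constant is NOT known to be
irrational; this file proves an identity and a `2`-power integrality, nothing diophantine.

## What is proved, and how (the printed proof, with one substitution)
* `u_eq_binomSum` (Lemma 3 in the normalisation `u_n = −a_n/4`): `u_n = Σ_{j=0}^{n} binom(n,j)·binom(n−½,j)·binom(n+j−½,j)`
  for ALL `n`. The source derives Lemma 3 from the partial-fraction form of `a_n` by a terminating `₆F₅ → ₃F₂`
  transformation with an `ε`-limit; the tree's `u_n` being DEFINED by Zudilin's recursion (2) with `u₀ = 1`,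
  `u₁ = 7/4`, we prove instead that the binomial sum solves that recursion — by an explicit creative-telescoping
  (Gosper–Zeilberger) certificate `cert`, found for this file and checked by `ring` (`telescope`) — and has the same
  two initial values; uniqueness (`Zudilin2003.IsSolution.ext_of_init`) concludes. (Deviation from print: certificate
  instead of the hypergeometric transformation; the statement is the printed one.)
* `theorem1`: `2^{4n}·u_n ∈ ℤ` for all `n` (so `2^{4n}a_n = −2^{4n+2}u_n ∈ ℤ`, Theorem 1; `theorem1_printed` is the
  first conjunct `2^{4n+2}u_n ∈ ℤ` of the cell's `Zudilin2003.krTheorems`). PROOF AS PRINTED: "By Lemma 2 [the brick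
  `R₂(α,β;t) = 2^{2(α−β)}(t+β−½)_{α−β}/(α−β)!` takes integer values at integers `t`] … the numbers `2^{2n}binom(n−½,j)`
  and `2^{2n}binom(n+j−½,j)` are integers. Given the expression for `a_n` in Lemma 3, this implies the assertion."
  The brick integrality is `oddRun`: `(2^m/m!)·∏_{i<m}(2c+1+2i) ∈ ℕ`, realised by the Pascal-type recursion
  `Q(c+1,m+1) = Q(c,m+1) + 4Q(c+1,m)`, `Q(0,m) = binom(2m,m)` (`oddRun_eq`), with `4^j·binom(n−½,j) = Q(n−j,j)`
  and `4^j·binom(n+j−½,j) = Q(n,j)`.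
Not here: Theorem 2 (`2^{4n}d_{2n}² b_n ∈ ℤ`, via Andrews' identity) — the second conjunct of `krTheorems` stays cited.
-/

noncomputable section

open Finset

namespace Literature.NumberTheory.Irrationality.KrattenthalerRivoal2008

open Zudilin2003 (u IsSolution sol sol_isSolution)

/-! ### Generalised binomial coefficients `binom(x, j)` for rational `x` -/

/-- `binom(x, j) = x(x−1)⋯(x−j+1)/j!` for rational `x` (the `binom(n−½, j)` of the source).
[cite: KrattenthalerRivoal2008Catalan, Sect. 3, Lemma 3] -/
def gbinom (x : ℚ) (j : ℕ) : ℚ := (∏ i ∈ range j, (x - i)) / (j.factorial : ℚ)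

/-- `binom(x, 0) = 1`. [cite: KrattenthalerRivoal2008Catalan, Sect. 3, Lemma 3] -/
@[simp] theorem gbinom_zero (x : ℚ) : gbinom x 0 = 1 := by simp [gbinom]

/-- `binom(x, 1) = x`. [cite: KrattenthalerRivoal2008Catalan, Sect. 3, Lemma 3] -/
@[simp] theorem gbinom_one (x : ℚ) : gbinom x 1 = x := by simp [gbinom]

/-- `binom(x, j+1)·(j+1) = binom(x, j)·(x − j)`. [cite: KrattenthalerRivoal2008Catalan, Sect. 3, Lemma 3] -/
theorem gbinom_succ (x : ℚ) (j : ℕ) : gbinom x (j + 1) * ((j : ℚ) + 1) = gbinom x j * (x - j) := by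
  unfold gbinom
  rw [prod_range_succ, Nat.factorial_succ]
  push_cast
  have hj : ((j : ℚ) + 1) ≠ 0 := by positivity
  have hf : ((j.factorial : ℕ) : ℚ) ≠ 0 := by positivity
  field_simp

/-- `binom(x+1, j)·(x+1−j) = binom(x, j)·(x+1)`. [cite: KrattenthalerRivoal2008Catalan, Sect. 3, Lemma 3] -/
theorem gbinom_succ_left (x : ℚ) (j : ℕ) : gbinom (x + 1) j * (x + 1 - j) = gbinom x j * (x + 1) := by
  unfold gbinom
  have key : (∏ i ∈ range j, (x + 1 - i)) * (x + 1 - j) = (x + 1) * ∏ i ∈ range j, (x - i) := by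
    have h1 : (∏ i ∈ range j, (x + 1 - i)) * (x + 1 - j) = ∏ i ∈ range (j + 1), (x + 1 - i) := by
      rw [prod_range_succ]
    rw [h1, prod_range_succ']
    simp only [Nat.cast_zero, sub_zero, Nat.cast_succ]
    rw [mul_comm]
    congr 1
    exact prod_congr rfl fun i _ => by ring
  rw [div_mul_eq_mul_div, key]
  ring

/-- `binom(x+1, j+1)·(j+1) = binom(x, j)·(x+1)`. [cite: KrattenthalerRivoal2008Catalan, Sect. 3, Lemma 3] -/
theorem gbinom_succ_succ (x : ℚ) (j : ℕ) : gbinom (x + 1) (j + 1) * ((j : ℚ) + 1) = gbinom x j * (x + 1) := by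
  unfold gbinom
  rw [prod_range_succ', Nat.factorial_succ]
  push_cast
  simp only [sub_zero]
  have hj : ((j : ℚ) + 1) ≠ 0 := by positivity
  have hf : ((j.factorial : ℕ) : ℚ) ≠ 0 := by positivity
  have hp : ∏ i ∈ range j, (x + 1 - ((i : ℚ) + 1)) = ∏ i ∈ range j, (x - i) :=
    prod_congr rfl fun i _ => by ring
  rw [hp]
  field_simp

/-- At natural arguments `binom(n, j)` is the ordinary binomial coefficient (zero for `j > n`).
[cite: KrattenthalerRivoal2008Catalan, Sect. 3, Lemma 3] -/
theorem gbinom_nat (n : ℕ) : ∀ j : ℕ, gbinom (n : ℚ) j = (n.choose j : ℚ) := by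
  intro j
  induction j with
  | zero => simp
  | succ j ih =>
    have hj : ((j : ℚ) + 1) ≠ 0 := by positivity
    have h := gbinom_succ (n : ℚ) j
    rw [ih] at h
    have h' : gbinom (n : ℚ) (j + 1) = (n.choose j : ℚ) * ((n : ℚ) - j) / ((j : ℚ) + 1) := by
      rw [eq_div_iff hj]; exact h
    rw [h']
    rcases Nat.lt_or_ge j n with hlt | hge
    · have e := Nat.choose_succ_right_eq n j
      have e' : ((n.choose (j + 1) : ℕ) : ℚ) * ((j : ℚ) + 1) = (n.choose j : ℚ) * ((n : ℚ) - j) := by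
        have := congrArg (fun m : ℕ => (m : ℚ)) e
        push_cast [Nat.cast_sub hlt.le] at this
        exact this
      rw [eq_comm, eq_div_iff hj]
      exact e'
    · rcases hge.eq_or_lt with h0 | h0
      · subst h0
        rw [Nat.choose_succ_self]
        simp
      · rw [Nat.choose_eq_zero_of_lt h0, Nat.choose_eq_zero_of_lt (by omega)]
        simp

/-- `binom(n, j) = 0` for naturals `j > n`. [cite: KrattenthalerRivoal2008Catalan, Sect. 3, Lemma 3] -/
theorem gbinom_nat_eq_zero {n j : ℕ} (h : n < j) : gbinom (n : ℚ) j = 0 := by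
  rw [gbinom_nat, Nat.choose_eq_zero_of_lt h, Nat.cast_zero]

/-! ### The binomial sum of Lemma 3 and its creative-telescoping certificate -/

/-- The summand `binom(n,j)·binom(n−½,j)·binom(n+j−½,j)` of Lemma 3.
[cite: KrattenthalerRivoal2008Catalan, Sect. 3, Lemma 3] -/
def summand (n j : ℕ) : ℚ :=
  gbinom (n : ℚ) j * gbinom ((n : ℚ) - 1 / 2) j * gbinom ((n : ℚ) + j - 1 / 2) j

/-- The binomial sum `Σ_{j=0}^{n} binom(n,j)·binom(n−½,j)·binom(n+j−½,j)` (`= −a_n/4` in the source).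
[cite: KrattenthalerRivoal2008Catalan, Sect. 3, Lemma 3] -/
def binomSum (n : ℕ) : ℚ := ∑ j ∈ range (n + 1), summand n j

/-- The summand vanishes beyond `j = n`. [cite: KrattenthalerRivoal2008Catalan, Sect. 3, Lemma 3] -/
theorem summand_eq_zero {n j : ℕ} (h : n < j) : summand n j = 0 := by
  simp [summand, gbinom_nat_eq_zero h]

/-- `binomSum 0 = 1 = u₀`. [cite: KrattenthalerRivoal2008Catalan, Sect. 3, Lemma 3] -/
theorem binomSum_zero : binomSum 0 = 1 := by
  simp [binomSum, summand]

/-- `binomSum 1 = 7/4 = u₁`. [cite: KrattenthalerRivoal2008Catalan, Sect. 3, Lemma 3] -/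
theorem binomSum_one : binomSum 1 = 7 / 4 := by
  rw [binomSum, sum_range_succ, sum_range_one]
  simp only [summand, gbinom_zero, gbinom_one]
  norm_num

/-- The polynomial part of the creative-telescoping certificate (found for this file by Gosper–Zeilberger against
Zudilin's recursion; checked below by `ring`). [cite: KrattenthalerRivoal2008Catalan, Sect. 3 (Lemma 3)] -/
def certPoly (n j : ℚ) : ℚ :=
  320 * j ^ 2 * n ^ 4 + 1472 * j ^ 2 * n ^ 3 + 2272 * j ^ 2 * n ^ 2 + 1328 * j ^ 2 * n + 260 * j ^ 2
    + 1920 * j * n ^ 5 + 11712 * j * n ^ 4 + 27776 * j * n ^ 3 + 32256 * j * n ^ 2 + 18568 * j * n + 4212 * j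
    - 3520 * n ^ 6 - 28032 * n ^ 5 - 90960 * n ^ 4 - 153664 * n ^ 3 - 142484 * n ^ 2 - 68856 * n - 13559

/-- The certificate `G(n,j) = 4j³·P(n,j)·binom(n+2,j)·binom(n−½,j)·binom(n+j−½,j)/((n+2)(2n+3−2j)(2n+1−2j))`
(the denominators never vanish at naturals). [cite: KrattenthalerRivoal2008Catalan, Sect. 3 (Lemma 3)] -/
def cert (n j : ℕ) : ℚ :=
  4 * (j : ℚ) ^ 3 * certPoly n j * gbinom ((n : ℚ) + 2) j * gbinom ((n : ℚ) - 1 / 2) j *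
      gbinom ((n : ℚ) + j - 1 / 2) j /
    (((n : ℚ) + 2) * (2 * (n : ℚ) + 3 - 2 * j) * (2 * (n : ℚ) + 1 - 2 * j))

/-- Zudilin's `p(n) = 20n²−8n+1` (arXiv:math/0201024 (3); `Zudilin2003.p` at `ℚ`).
[cite: KrattenthalerRivoal2008Catalan, Sect. 2 (the recursion of [zu6])] -/
def pZ (x : ℚ) : ℚ := 20 * x ^ 2 - 8 * x + 1

/-- Zudilin's `q(n) = 3520n⁶+5632n⁵+2064n⁴−384n³−156n²+16n+7` (arXiv:math/0201024 (3); `Zudilin2003.q` at `ℚ`).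
[cite: KrattenthalerRivoal2008Catalan, Sect. 2 (the recursion of [zu6])] -/
def qZ (x : ℚ) : ℚ :=
  3520 * x ^ 6 + 5632 * x ^ 5 + 2064 * x ^ 4 - 384 * x ^ 3 - 156 * x ^ 2 + 16 * x + 7

/-- An odd integer is not zero (as a rational): `2(n+k−j)+1 ≠ 0`. [cite: KrattenthalerRivoal2008Catalan, Sect. 3, Lemma 2] -/
theorem odd_ne_zero (n j : ℕ) (k : ℤ) : (2 * ((n : ℚ) + k - j) + 1) ≠ 0 := by
  intro h
  have h3 : (2 * ((n : ℤ) + k - j) + 1 : ℤ) = 0 := by exact_mod_cast h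
  omega

/-- **The telescoping identity** behind Lemma 3: with `c₂ = (2n+3)²(2n+4)²p(n+1)`, `c₁ = −q(n+1)`,
`c₀ = −(2n+1)²(2n+2)²p(n+2)` (Zudilin's recursion (2) at `n+1`, for `x_n, x_{n+1}, x_{n+2}`),
`c₂F(n+2,j) + c₁F(n+1,j) + c₀F(n,j) = G(n,j+1) − G(n,j)` for ALL naturals `n, j`
(`F = summand`, `G = cert`). [cite: KrattenthalerRivoal2008Catalan, Sect. 3 (Lemma 3)] -/
theorem telescope (n j : ℕ) :
    (2 * (n : ℚ) + 3) ^ 2 * (2 * (n : ℚ) + 4) ^ 2 * pZ ((n : ℚ) + 1) * summand (n + 2) j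
      - qZ ((n : ℚ) + 1) * summand (n + 1) j
      - (2 * (n : ℚ) + 1) ^ 2 * (2 * (n : ℚ) + 2) ^ 2 * pZ ((n : ℚ) + 2) * summand n j
    = cert n (j + 1) - cert n j := by
  -- nonvanishing denominators
  have hn1 : ((n : ℚ) + 1) ≠ 0 := by positivity
  have hn2 : ((n : ℚ) + 2) ≠ 0 := by positivity
  have hn3 : ((n : ℚ) + 3) ≠ 0 := by positivity
  have hj1 : ((j : ℚ) + 1) ≠ 0 := by positivity
  have hp1 : (2 * (n : ℚ) + 1) ≠ 0 := by positivity
  have hp3 : (2 * (n : ℚ) + 3) ≠ 0 := by positivity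
  have d1 : (2 * (n : ℚ) + 1 - 2 * j) ≠ 0 := by
    have := odd_ne_zero n j 0; push_cast at this
    intro h; apply this; linarith
  have d3 : (2 * (n : ℚ) + 3 - 2 * j) ≠ 0 := by
    have := odd_ne_zero n j 1; push_cast at this
    intro h; apply this; linarith
  have dm1 : (2 * (n : ℚ) - 1 - 2 * j) ≠ 0 := by
    have := odd_ne_zero n j (-1); push_cast at this
    intro h; apply this; linarith
  have d1s : (2 * (n : ℚ) + 3 - 2 * ((j : ℚ) + 1)) ≠ 0 := by
    intro h; apply d1; linarith
  have dm1s : (2 * (n : ℚ) + 1 - 2 * ((j : ℚ) + 1)) ≠ 0 := by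
    intro h; apply dm1; linarith
  -- integer-binomial atoms in terms of `B = binom(n+3, j+1)`
  have a2' : gbinom ((n : ℚ) + 2) j * ((n : ℚ) + 3) = gbinom ((n : ℚ) + 3) (j + 1) * ((j : ℚ) + 1) := by
    have h := gbinom_succ_succ ((n : ℚ) + 2) j
    rw [show (n : ℚ) + 2 + 1 = (n : ℚ) + 3 by ring] at h
    linear_combination -h
  have a3' : gbinom ((n : ℚ) + 2) (j + 1) * ((n : ℚ) + 3) =
      gbinom ((n : ℚ) + 3) (j + 1) * ((n : ℚ) + 2 - j) := by
    have h := gbinom_succ_left ((n : ℚ) + 2) (j + 1)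
    rw [show (n : ℚ) + 2 + 1 = (n : ℚ) + 3 by ring] at h
    push_cast at h
    linear_combination -h
  have a1' : gbinom ((n : ℚ) + 1) j * ((n : ℚ) + 2) = gbinom ((n : ℚ) + 2) j * ((n : ℚ) + 2 - j) := by
    have h := gbinom_succ_left ((n : ℚ) + 1) j
    rw [show (n : ℚ) + 1 + 1 = (n : ℚ) + 2 by ring] at h
    linear_combination -h
  have a0' : gbinom (n : ℚ) j * ((n : ℚ) + 1) = gbinom ((n : ℚ) + 1) j * ((n : ℚ) + 1 - j) := by
    have h := gbinom_succ_left (n : ℚ) j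
    linear_combination -h
  have a2 : gbinom ((n : ℚ) + 2) j = gbinom ((n : ℚ) + 3) (j + 1) * ((j : ℚ) + 1) / ((n : ℚ) + 3) := by
    rw [eq_div_iff hn3]; exact a2'
  have a3 : gbinom ((n : ℚ) + 2) (j + 1) =
      gbinom ((n : ℚ) + 3) (j + 1) * ((n : ℚ) + 2 - j) / ((n : ℚ) + 3) := by
    rw [eq_div_iff hn3]; exact a3'
  have a1 : gbinom ((n : ℚ) + 1) j =
      gbinom ((n : ℚ) + 3) (j + 1) * ((j : ℚ) + 1) * ((n : ℚ) + 2 - j) / (((n : ℚ) + 2) * ((n : ℚ) + 3)) := by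
    rw [eq_div_iff (mul_ne_zero hn2 hn3)]
    linear_combination ((n : ℚ) + 3) * a1' + ((n : ℚ) + 2 - j) * a2'
  have a0 : gbinom (n : ℚ) j =
      gbinom ((n : ℚ) + 3) (j + 1) * ((j : ℚ) + 1) * ((n : ℚ) + 2 - j) * ((n : ℚ) + 1 - j) /
        (((n : ℚ) + 1) * ((n : ℚ) + 2) * ((n : ℚ) + 3)) := by
    rw [eq_div_iff (mul_ne_zero (mul_ne_zero hn1 hn2) hn3)]
    linear_combination ((n : ℚ) + 2) * ((n : ℚ) + 3) * a0' + ((n : ℚ) + 1 - j) * ((n : ℚ) + 3) * a1'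
      + ((n : ℚ) + 1 - j) * ((n : ℚ) + 2 - j) * a2'
  -- half-integer atoms in terms of `H₀ = binom(n−½, j)` and `K₀ = binom(n+j−½, j)`
  have h1' : gbinom ((n : ℚ) + 1 - 1 / 2) j * (2 * (n : ℚ) + 1 - 2 * j) =
      gbinom ((n : ℚ) - 1 / 2) j * (2 * (n : ℚ) + 1) := by
    have h := gbinom_succ_left ((n : ℚ) - 1 / 2) j
    rw [show (n : ℚ) - 1 / 2 + 1 = (n : ℚ) + 1 - 1 / 2 by ring] at h
    linear_combination 2 * h
  have h2' : gbinom ((n : ℚ) + 2 - 1 / 2) j * (2 * (n : ℚ) + 3 - 2 * j) =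
      gbinom ((n : ℚ) + 1 - 1 / 2) j * (2 * (n : ℚ) + 3) := by
    have h := gbinom_succ_left ((n : ℚ) + 1 - 1 / 2) j
    rw [show (n : ℚ) + 1 - 1 / 2 + 1 = (n : ℚ) + 2 - 1 / 2 by ring] at h
    linear_combination 2 * h
  have h0s : gbinom ((n : ℚ) - 1 / 2) (j + 1) * (2 * ((j : ℚ) + 1)) =
      gbinom ((n : ℚ) - 1 / 2) j * (2 * (n : ℚ) - 1 - 2 * j) := by
    have h := gbinom_succ ((n : ℚ) - 1 / 2) j
    linear_combination 2 * h
  have k1' : gbinom ((n : ℚ) + 1 + j - 1 / 2) j * (2 * (n : ℚ) + 1) =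
      gbinom ((n : ℚ) + j - 1 / 2) j * (2 * (n : ℚ) + 2 * j + 1) := by
    have h := gbinom_succ_left ((n : ℚ) + j - 1 / 2) j
    rw [show (n : ℚ) + j - 1 / 2 + 1 = (n : ℚ) + 1 + j - 1 / 2 by ring] at h
    linear_combination 2 * h
  have k2' : gbinom ((n : ℚ) + 2 + j - 1 / 2) j * (2 * (n : ℚ) + 3) =
      gbinom ((n : ℚ) + 1 + j - 1 / 2) j * (2 * (n : ℚ) + 2 * j + 3) := by
    have h := gbinom_succ_left ((n : ℚ) + 1 + j - 1 / 2) j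
    rw [show (n : ℚ) + 1 + j - 1 / 2 + 1 = (n : ℚ) + 2 + j - 1 / 2 by ring] at h
    linear_combination 2 * h
  have k0s : gbinom ((n : ℚ) + ((j : ℚ) + 1) - 1 / 2) (j + 1) * (2 * ((j : ℚ) + 1)) =
      gbinom ((n : ℚ) + j - 1 / 2) j * (2 * (n : ℚ) + 2 * j + 1) := by
    have h := gbinom_succ_succ ((n : ℚ) + j - 1 / 2) j
    rw [show (n : ℚ) + j - 1 / 2 + 1 = (n : ℚ) + ((j : ℚ) + 1) - 1 / 2 by ring] at h
    linear_combination 2 * h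
  have h1 : gbinom ((n : ℚ) + 1 - 1 / 2) j =
      gbinom ((n : ℚ) - 1 / 2) j * (2 * (n : ℚ) + 1) / (2 * (n : ℚ) + 1 - 2 * j) := by
    rw [eq_div_iff d1]; exact h1'
  have h2 : gbinom ((n : ℚ) + 2 - 1 / 2) j =
      gbinom ((n : ℚ) - 1 / 2) j * (2 * (n : ℚ) + 1) * (2 * (n : ℚ) + 3) /
        ((2 * (n : ℚ) + 1 - 2 * j) * (2 * (n : ℚ) + 3 - 2 * j)) := by
    rw [eq_div_iff (mul_ne_zero d1 d3)]
    linear_combination (2 * (n : ℚ) + 1 - 2 * j) * h2' + (2 * (n : ℚ) + 3) * h1'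
  have h0 : gbinom ((n : ℚ) - 1 / 2) (j + 1) =
      gbinom ((n : ℚ) - 1 / 2) j * (2 * (n : ℚ) - 1 - 2 * j) / (2 * ((j : ℚ) + 1)) := by
    rw [eq_div_iff (mul_ne_zero two_ne_zero hj1)]; exact h0s
  have k1 : gbinom ((n : ℚ) + 1 + j - 1 / 2) j =
      gbinom ((n : ℚ) + j - 1 / 2) j * (2 * (n : ℚ) + 2 * j + 1) / (2 * (n : ℚ) + 1) := by
    rw [eq_div_iff hp1]; exact k1'
  have k2 : gbinom ((n : ℚ) + 2 + j - 1 / 2) j =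
      gbinom ((n : ℚ) + j - 1 / 2) j * (2 * (n : ℚ) + 2 * j + 1) * (2 * (n : ℚ) + 2 * j + 3) /
        ((2 * (n : ℚ) + 1) * (2 * (n : ℚ) + 3)) := by
    rw [eq_div_iff (mul_ne_zero hp1 hp3)]
    linear_combination (2 * (n : ℚ) + 1) * k2' + (2 * (n : ℚ) + 2 * j + 3) * k1'
  have k0 : gbinom ((n : ℚ) + ((j : ℚ) + 1) - 1 / 2) (j + 1) =
      gbinom ((n : ℚ) + j - 1 / 2) j * (2 * (n : ℚ) + 2 * j + 1) / (2 * ((j : ℚ) + 1)) := by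
    rw [eq_div_iff (mul_ne_zero two_ne_zero hj1)]; exact k0s
  unfold summand cert certPoly pZ qZ
  push_cast
  rw [a0, a1, a2, a3, h1, h2, h0, k1, k2, k0]
  field_simp
  ring

/-- **The binomial sum solves Zudilin's recursion** (shifted form): for all `n`,
`(2n+3)²(2n+4)²p(n+1)·S(n+2) − q(n+1)·S(n+1) − (2n+1)²(2n+2)²p(n+2)·S(n) = 0`.
[cite: KrattenthalerRivoal2008Catalan, Sect. 3 (Lemma 3)] -/
theorem binomSum_rec (n : ℕ) :
    (2 * (n : ℚ) + 3) ^ 2 * (2 * (n : ℚ) + 4) ^ 2 * pZ ((n : ℚ) + 1) * binomSum (n + 2)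
      - qZ ((n : ℚ) + 1) * binomSum (n + 1)
      - (2 * (n : ℚ) + 1) ^ 2 * (2 * (n : ℚ) + 2) ^ 2 * pZ ((n : ℚ) + 2) * binomSum n = 0 := by
  have hsum : ∑ j ∈ range (n + 3),
      ((2 * (n : ℚ) + 3) ^ 2 * (2 * (n : ℚ) + 4) ^ 2 * pZ ((n : ℚ) + 1) * summand (n + 2) j
        - qZ ((n : ℚ) + 1) * summand (n + 1) j
        - (2 * (n : ℚ) + 1) ^ 2 * (2 * (n : ℚ) + 2) ^ 2 * pZ ((n : ℚ) + 2) * summand n j)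
      = ∑ j ∈ range (n + 3), (cert n (j + 1) - cert n j) :=
    sum_congr rfl fun j _ => telescope n j
  rw [Finset.sum_range_sub] at hsum
  have hG0 : cert n 0 = 0 := by simp [cert]
  have hG3 : cert n (n + 3) = 0 := by
    have hz : gbinom ((n : ℚ) + 2) (n + 3) = 0 := by
      have := gbinom_nat_eq_zero (n := n + 2) (j := n + 3) (by omega)
      push_cast at this
      exact this
    simp [cert, hz]
  rw [hG0, hG3, sub_zero, sum_sub_distrib, sum_sub_distrib, ← mul_sum, ← mul_sum, ← mul_sum] at hsum
  have e2 : ∑ j ∈ range (n + 3), summand (n + 2) j = binomSum (n + 2) := rfl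
  have e1 : ∑ j ∈ range (n + 3), summand (n + 1) j = binomSum (n + 1) := by
    rw [binomSum, show n + 3 = n + 1 + 1 + 1 from rfl, sum_range_succ _ (n + 1 + 1),
      summand_eq_zero (by omega : n + 1 < n + 1 + 1), add_zero]
  have e0 : ∑ j ∈ range (n + 3), summand n j = binomSum n := by
    rw [binomSum, show n + 3 = n + 1 + 1 + 1 from rfl, sum_range_succ _ (n + 1 + 1), sum_range_succ _ (n + 1),
      summand_eq_zero (by omega : n < n + 1 + 1), summand_eq_zero (by omega : n < n + 1), add_zero, add_zero]
  rw [e2, e1, e0] at hsum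
  linear_combination hsum

/-- The binomial sum solves Zudilin's recursion (2) in the tree's sense. [cite: KrattenthalerRivoal2008Catalan, Sect. 3 (Lemma 3)] -/
theorem binomSum_isSolution : IsSolution binomSum := by
  intro n hn
  obtain ⟨m, rfl⟩ : ∃ m, n = m + 1 := ⟨n - 1, by omega⟩
  have h := binomSum_rec m
  simp only [Nat.add_sub_cancel, show m + 1 + 1 = m + 2 from rfl]
  unfold pZ qZ at h
  unfold Zudilin2003.p Zudilin2003.q
  push_cast
  linear_combination h

/-- **Lemma 3 (Krattenthaler–Rivoal 2008; Rivoal 2006)**, in the normalisation `u_n = −a_n/4`: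
`u_n = Σ_{j=0}^{n} binom(n,j)·binom(n−½,j)·binom(n+j−½,j)` for every `n`, where `u_n` is Zudilin's solution of the
recursion (2) with `u₀ = 1`, `u₁ = 7/4`. [cite: KrattenthalerRivoal2008Catalan, Sect. 3, Lemma 3] -/
theorem u_eq_binomSum : u = binomSum :=
  IsSolution.ext_of_init (sol_isSolution 1 (7 / 4)) binomSum_isSolution
    (by rw [binomSum_zero]; rfl) (by rw [binomSum_one]; rfl)

/-! ### The brick `2^{2m}(t−½)_m/m! ∈ ℤ` (Lemma 2) as a Pascal-type recursion, and Theorem 1 -/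

/-- `Q(c, m) = (2^m/m!)·(2c+1)(2c+3)⋯(2c+2m−1)` as a NATURAL number, through the recursion
`Q(c+1, m+1) = Q(c, m+1) + 4·Q(c+1, m)`, `Q(c, 0) = 1`, `Q(0, m) = binom(2m, m)` (the integrality of the brick
`R₂(α,β;t) = 2^{2(α−β)}(t+β−½)_{α−β}/(α−β)!` at integer points `t ≥ 1`, Lemma 2 of the source).
[cite: KrattenthalerRivoal2008Catalan, Sect. 3, Lemma 2] -/
def oddRun : ℕ → ℕ → ℕ
  | _, 0 => 1
  | 0, m + 1 => Nat.centralBinom (m + 1)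
  | c + 1, m + 1 => oddRun c (m + 1) + 4 * oddRun (c + 1) m
termination_by c m => c + m

/-- The closed form `(2^m/m!)·∏_{i<m}(2c+1+2i)` of `Q(c, m)`, as a rational number.
[cite: KrattenthalerRivoal2008Catalan, Sect. 3, Lemma 2] -/
def oddRunQ (c m : ℕ) : ℚ := 2 ^ m / (m.factorial : ℚ) * ∏ i ∈ range m, (2 * (c : ℚ) + 1 + 2 * i)

/-- `Q(0, m) = (2^m/m!)·1·3⋯(2m−1) = binom(2m, m)`. [cite: KrattenthalerRivoal2008Catalan, Sect. 3, Lemma 2] -/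
theorem oddRunQ_zero_left (m : ℕ) : oddRunQ 0 m = (Nat.centralBinom m : ℚ) := by
  induction m with
  | zero => simp [oddRunQ]
  | succ m ih =>
    have hrec := Nat.succ_mul_centralBinom_succ m
    have hrec' : ((m : ℚ) + 1) * (Nat.centralBinom (m + 1) : ℚ) =
        2 * (2 * (m : ℚ) + 1) * (Nat.centralBinom m : ℚ) := by
      have := congrArg (fun k : ℕ => (k : ℚ)) hrec
      push_cast at this
      exact this
    have hm : ((m : ℚ) + 1) ≠ 0 := by positivity
    have hf : ((m.factorial : ℕ) : ℚ) ≠ 0 := by positivity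
    have step : oddRunQ 0 (m + 1) = oddRunQ 0 m * (2 * (2 * (m : ℚ) + 1)) / ((m : ℚ) + 1) := by
      unfold oddRunQ
      rw [prod_range_succ, Nat.factorial_succ, pow_succ]
      push_cast
      field_simp
      ring
    rw [step, ih, div_eq_iff hm]
    linear_combination -hrec'

/-- The Pascal-type step `Q(c+1, m+1) = Q(c, m+1) + 4·Q(c+1, m)` for the closed form.
[cite: KrattenthalerRivoal2008Catalan, Sect. 3, Lemma 2] -/
theorem oddRunQ_pascal (c m : ℕ) : oddRunQ (c + 1) (m + 1) = oddRunQ c (m + 1) + 4 * oddRunQ (c + 1) m := by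
  unfold oddRunQ
  rw [prod_range_succ, prod_range_succ' _ m, Nat.factorial_succ, pow_succ]
  push_cast
  have hp : ∏ i ∈ range m, (2 * (c : ℚ) + 1 + 2 * ((i : ℚ) + 1)) =
      ∏ i ∈ range m, (2 * ((c : ℚ) + 1) + 1 + 2 * i) := prod_congr rfl fun i _ => by ring
  rw [hp]
  have hm : ((m : ℚ) + 1) ≠ 0 := by positivity
  have hf : ((m.factorial : ℕ) : ℚ) ≠ 0 := by positivity
  field_simp
  ring

/-- `Q(c, m)` IS the closed form: `(Q(c,m) : ℚ) = (2^m/m!)·∏_{i<m}(2c+1+2i)`; in particular the right-hand side is a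
natural number. [cite: KrattenthalerRivoal2008Catalan, Sect. 3, Lemma 2] -/
theorem oddRun_eq (c m : ℕ) : (oddRun c m : ℚ) = oddRunQ c m := by
  induction m generalizing c with
  | zero => simp [oddRun, oddRunQ]
  | succ m ihm =>
    induction c with
    | zero => rw [oddRun, oddRunQ_zero_left]
    | succ c ihc => rw [oddRun, oddRunQ_pascal]; push_cast; rw [ihc, ihm]

/-- `4^j·binom(n−½, j) = Q(n−j, j)` for `j ≤ n` (the run of odd numbers `2n−2j+1, …, 2n−1`).
[cite: KrattenthalerRivoal2008Catalan, Sect. 3, proof of Theorem 1] -/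
theorem four_pow_mul_gbinom_sub_half {n j : ℕ} (h : j ≤ n) :
    4 ^ j * gbinom ((n : ℚ) - 1 / 2) j = oddRunQ (n - j) j := by
  unfold gbinom oddRunQ
  have hrefl : ∏ i ∈ range j, (2 * (((n - j : ℕ) : ℚ)) + 1 + 2 * i) = ∏ i ∈ range j, (2 * (n : ℚ) - 1 - 2 * i) := by
    rw [← prod_range_reflect (fun i : ℕ => (2 * (n : ℚ) - 1 - 2 * i)) j]
    refine prod_congr rfl fun i hi => ?_
    rw [mem_range] at hi
    push_cast [Nat.cast_sub h, Nat.cast_sub (by omega : 1 + i ≤ j), Nat.sub_sub]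
    ring
  have hsplit : ∏ i ∈ range j, (2 * (n : ℚ) - 1 - 2 * i) = 2 ^ j * ∏ i ∈ range j, ((n : ℚ) - 1 / 2 - i) := by
    rw [show (2 : ℚ) ^ j = ∏ _i ∈ range j, (2 : ℚ) by simp, ← prod_mul_distrib]
    exact prod_congr rfl fun i _ => by ring
  rw [hrefl, hsplit, show (4 : ℚ) ^ j = 2 ^ j * 2 ^ j by rw [← mul_pow]; norm_num]
  ring

/-- `4^j·binom(n+j−½, j) = Q(n, j)` (the run of odd numbers `2n+1, …, 2n+2j−1`).
[cite: KrattenthalerRivoal2008Catalan, Sect. 3, proof of Theorem 1] -/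
theorem four_pow_mul_gbinom_add_half (n j : ℕ) :
    4 ^ j * gbinom ((n : ℚ) + j - 1 / 2) j = oddRunQ n j := by
  unfold gbinom oddRunQ
  have hrefl : ∏ i ∈ range j, (2 * (n : ℚ) + 1 + 2 * i) = ∏ i ∈ range j, (2 * (n : ℚ) + 2 * j - 1 - 2 * i) := by
    rw [← prod_range_reflect (fun i : ℕ => (2 * (n : ℚ) + 2 * j - 1 - 2 * i)) j]
    refine prod_congr rfl fun i hi => ?_
    rw [mem_range] at hi
    push_cast [Nat.cast_sub (by omega : 1 + i ≤ j), Nat.sub_sub]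
    ring
  have hsplit : ∏ i ∈ range j, (2 * (n : ℚ) + 2 * j - 1 - 2 * i) =
      2 ^ j * ∏ i ∈ range j, ((n : ℚ) + j - 1 / 2 - i) := by
    rw [show (2 : ℚ) ^ j = ∏ _i ∈ range j, (2 : ℚ) by simp, ← prod_mul_distrib]
    exact prod_congr rfl fun i _ => by ring
  rw [hrefl, hsplit, show (4 : ℚ) ^ j = 2 ^ j * 2 ^ j by rw [← mul_pow]; norm_num]
  ring

/-- **Theorem 1 (Krattenthaler–Rivoal 2008), sharp form of the printed proof**: `2^{4n}·u_n` is an integer for every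
`n` — indeed `2^{4n}u_n = Σ_j binom(n,j)·16^{n−j}·Q(n−j,j)·Q(n,j) ∈ ℕ`. (The source states `2^{4n}a_n ∈ ℤ` with
`a_n = −4u_n`; its proof gives exactly this.) [cite: KrattenthalerRivoal2008Catalan, Sect. 3, Theorem 1] -/
theorem theorem1 (n : ℕ) : ∃ z : ℤ, (z : ℚ) = 2 ^ (4 * n) * u n := by
  refine ⟨((∑ j ∈ range (n + 1), n.choose j * 16 ^ (n - j) * oddRun (n - j) j * oddRun n j : ℕ) : ℤ), ?_⟩
  rw [u_eq_binomSum]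
  unfold binomSum
  rw [mul_sum]
  push_cast
  refine sum_congr rfl fun j hj => ?_
  have hjn : j ≤ n := by rw [mem_range] at hj; omega
  rw [oddRun_eq, oddRun_eq, ← four_pow_mul_gbinom_sub_half hjn, ← four_pow_mul_gbinom_add_half n j]
  unfold summand
  rw [gbinom_nat]
  have hpow : (2 : ℚ) ^ (4 * n) = 16 ^ (n - j) * 4 ^ j * 4 ^ j := by
    rw [show 4 * n = 4 * (n - j) + 2 * j + 2 * j by omega, pow_add, pow_add, pow_mul, pow_mul]
    norm_num
  rw [hpow]
  ring

/-- **Theorem 1 as printed / first conjunct of `Zudilin2003.krTheorems`**: `2^{4n+2}·u_n = −2^{4n}a_n ∈ ℤ`.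
[cite: KrattenthalerRivoal2008Catalan, Sect. 3, Theorem 1] -/
theorem theorem1_printed (n : ℕ) : ∃ z : ℤ, (z : ℚ) = 2 ^ (4 * n + 2) * u n := by
  obtain ⟨z, hz⟩ := theorem1 n
  exact ⟨4 * z, by push_cast; rw [hz, pow_add]; ring⟩

end Literature.NumberTheory.Irrationality.KrattenthalerRivoal2008
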